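/-
Copyright (c) 2026 the pub-hodgecm-mathlib formalisation cell (harness21).  Prover seat hodgecm-mathlib-K2E3-p03 (g3), Track B «K2-LIT» ∕ h413
(`stmt-HodgeConjecture-24833`), line `K2_E3_EllipticInputs`, unit U3b, ROAD J of ‹S_loc›, leaf (J3d-w) «rank-one mass at a dyadic ramified (wild) place», road (d-w),
LETTER (E-w): THE EP DATUM OF `U(Φ₂)_v` AT ANY RAMIFIED PLACE, BY TYPE — `r · ν₂(K₂) = (q − 1)∕(q + 1)` (√π) ∕ `(q − 1)∕2` (√u).  2026-09-04.
-/
import Summits.HodgeConjecture.HodgeConjecture.Theorems.K2E3EPIndicesRamified                     -- ★ (E-ram) p856782 (K2E4-p09 g2): §2 `relIndex_sharp_inf_level_eq_of_antifixed_uniformizer` (√π indices) + the whole J2♯ ∕ ROAD W ∕ R2 tool chain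
import Literature.NumberTheory.Automorphic.UnitaryTwoVertexEdgeStabilizerMassRatioRamifiedUnit    -- ★ LH4-p05 F6: `index_inf_subgroupOf_sharp_eq_two_of_unit` (`[K♯:I] = 2`), `index_inf_subgroupOf_cmLocalIntegralLevel_eq_of_unit` (`[K⁰:I] = q+1`) at a √u place
import HarnessLib

/-!
# K2_E3 road (h413), U3b ROAD J, leaf (J3d-w), road (d-w) — LETTER (E-w): KOTTWITZ'S EP DATUM OF `U(Φ₂)_v` AT ANY RAMIFIED PLACE, BY TYPE
# `r · ν₂(K₂) = (q_v − 1)∕(q_v + 1)` at a √π-type place, `r · ν₂(K₂) = (q_v − 1)∕2` at a √u-type place (Kottwitz 1988 §2; Rogawski 1990 §8.1, §12.6; Serre, Trees II.1.3; Tits 1979 §3.9)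

Cell `pub/hodgecm-mathlib` (D-0151), Track B, squad K2; DEAL (D26) K2E3-plan (g2) 02:28Z «ROAD (d-w) OWNER» = leaf (J3d-w)
`U3bCentralGermsLeaves.sig_K2E3CompatibleMeasureEPIdentityRankOneDyadicRamified` (PART C :333); CENSUS `K2/K2E3-p03/g3/CENSUS-J3dw.K2E3-p03-g3.md` fd3c4f7e, STEP 2 = letter W2 (E-w).
This is S1 of the (J3d-w) assembly — the WILD twin of ★ LETTER (E-ram) `K2E3EPIndicesRamified.exists_epDatum_of_ramified` (K2E4-p09 (g2), p856782), whose only use of `2 ∉ v`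
is to force the √π type (its §1).  At a ramified place `w ∣ v` of a CM field the anti-fixed element `α` of `L_w` (`σ_w α = −α`, ★ `exists_units_galAdicCompletionMap_complexConj_eq_neg_of_ramified`)
is a UNIT (√u-type: only at wild places, `2 ∈ v`) or a UNIFORMISER (√π-type: every tame place and the wild places `L_w = L⁺_v(√(uπ))`); here the type is an INPUT `(α) (hα) (hvα)`,
so that the (J3d-w) assembly can key S1 (this letter) and S3∕S4 (the masses) on the SAME `α`.  Same output shape as ★ LETTER E ∕ (E-ram):
`∃ f₂ r, IsLocSmooth f₂ ∧ ‹orbital integrals 1 ∕ 0 on the regular elliptic ∕ split classes› ∧ ‹f₂(b·1) = −r› ∧ r · (ν₂ ↑K₂).toReal = <number>`, `K₂ = U(Φ₂)(𝒪_v)`, `q = |𝓞_{L⁺}∕v|`.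

THE MATHEMATICS.  ROAD W (★ `rankOneEulerPoincareNonsplit_holds`): `U(Φ₂)_v` acts on the tree of `SL₂(L⁺_v)` through ★ `rhoVertexActPlace` (keyed by `α`), one vertex orbit, one dart
orbit; base dart `(v₀, v₁) = (𝒪², latt diag(1, ϖ_v))`.  √u (`|α|_w = 1`): `K⁰ = U(Φ₂)(𝒪_v)` fixes the VERTEX `v₀`, `K♯_η = e_w⁻¹(D_η GL₂(𝒪_w) D_η⁻¹)` (`η` any uniformiser of
`L_w`) fixes the EDGE `{v₀, v₁}` with its inversion; ★ F6 (LH4-p05): `[K⁰ : I] = q + 1`, `[K♯_η : I] = 2`, `I = K♯_η ⊓ K⁰`.  √π (`|α|_w = |ϖ_w|`): `K♯_α` fixes `v₁`, `K⁰` fixes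
`{v₁, v₀}`; ★ F7 ∕ ★ (E-ram) §2: `[K♯_α : I] = q + 1`, `[K⁰ : I] = 2`.  Kottwitz's relations (E), (N) at `(K♯, K⁰, I)` are read off the action (★
`epEllipticRelation_vertexEdgeLevels_of_vertexAction_local{,′}`, ★ `epNonEllipticRelation_vertexEdgeLevels_of_vertexAction_local{,′}` — the primed forms are the √u keying),
the glue WITH VALUE (★ `exists_isLocSmooth_classOrbitalIntegral_eq_one_zero_and_apply_of_relations`) gives Kottwitz's EP function `f` with `f(z) = ν(K♯)⁻¹ + ν(K⁰)⁻¹ − ν(I)⁻¹`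
at the central unit scalars (★ `scalar_mem_vertexEdgeLevels`), and with `r := ν(I)⁻¹ − ν(K♯)⁻¹ − ν(K⁰)⁻¹`:
`r · ν(K⁰) = [K⁰:I] − [K⁰:I]∕[K♯:I] − 1 = (q+1) − (q+1)∕2 − 1 = (q − 1)∕2` (√u) ∕ `= 2 − 2∕(q+1) − 1 = (q − 1)∕(q + 1)` (√π); in both cases `r · ν(I) = (q−1)∕(2(q+1))`
(★ (d-w-0) K2E3-p06 (g3) `inv_relIndex_add_inv_relIndex_of_ramified`, type-free).  No `|2|` anywhere: tame and wild places ride the same rails (ROAD W's point).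
* §1 `relIndex_sharp_inf_level_eq_of_antifixed_unit` — `[K♯_η : I] = 2 ∧ [K⁰ : I] = q + 1` at a √u place, for J2♯'s levels at `D_η` (★ F6 in the `P♯` currency ★ `forall_v_sharp_iff_coe_mem_map_conj`).
* §2 **`exists_epDatum_of_antifixed_uniformizer`** — (E-w-π): `r · ν₂(K₂) = (q − 1)∕(q + 1)` at ANY ramified place carrying an anti-fixed uniformiser (SUBSUMES (E-ram): ★ p856782's
  proof verbatim from its `hα0` line on; (E-ram) = this ∘ ★ `valued_eq_exp_neg_one_of_antifixed`).
* §3 **`exists_epDatum_of_antifixed_unit`** — (E-w-u): `r · ν₂(K₂) = (q − 1)∕2` at a √u-type (wild) place (the primed ROAD W lemmas, `D_η` for a uniformiser `η`, ★ F6 indices).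
* §4 `exists_epDatum_of_ramified_either` — type-free corollary at EVERY ramified place: `… ∧ (r · ν₂(K₂) = (q−1)∕(q+1) ∨ r · ν₂(K₂) = (q−1)∕2)` (the anti-fixed dichotomy).
THEOREMS ONLY (no definition, no instance, no notation, no named fact, no `sorry`); lane `--supports stmt-HodgeConjecture-24833 --as helper`.  HONEST LABEL: HC_CM is proved only
modulo the 7 printed citations (2 remaining named inputs: hLiu418 = stmt-HodgeConjecture-24832, h413 = stmt-HodgeConjecture-24833) until rung 0 closes; count-neutral helper;
(J3d-w) is NOT proved by this file (S1 only — the wild masses S3∕S4, letters W1∕W3 of the census, remain).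
## References
* [Kottwitz1988] R. E. Kottwitz, *Tamagawa numbers*, Ann. of Math. 127 (1988) 629–646, §2 Theorem 2 (the Euler–Poincaré function, `[K_σ : I]`).
* [Rogawski1990] J. D. Rogawski, *Automorphic Representations of Unitary Groups in Three Variables*, Ann. of Math. Stud. 123 (1990), §8.1 p. 117; §12.6 p. 174.
* [Serre1980Trees] J.-P. Serre, *Trees* (1980), Ch. II §1.3; [Tits1979] J. Tits, *Reductive groups over local fields*, PSPM 33.1 (1979), §2.7, §3.7, §3.9 (ramified `U(1,1)`: indices `2`, `q+1`).
* [Jacobowitz1962] R. Jacobowitz, *Hermitian forms over local fields*, Amer. J. Math. 84 (1962), §5 (the two ramified dyadic types `F(√u)`, `F(√π)`). -/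

set_option autoImplicit false
set_option linter.dupNamespace false  -- the mandated namespace repeats the summit's segment, as in every `Theorems/*.lean` here

noncomputable section

open scoped ValuativeRel Matrix MatrixGroups ENNReal NNReal
open Matrix ValuativeRel NumberField IsDedekindDomain MeasureTheory Measure

namespace Summit.HodgeConjecture.HodgeConjecture.Cruxes.H413.K2E3EPIndicesWild

open Literature.NumberTheory.Rogawski1990 Literature.MeasureTheory.Group
open Literature.NumberTheory.Automorphic Literature.NumberTheory.Automorphic.UnitaryGroup Literature.NumberTheory.Automorphic.HermitianLatticeTree
  Literature.NumberTheory.GaloisRepresentations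
open Summit.HodgeConjecture.HodgeConjecture.Cruxes.H413.K2E3EPValueIndexForm Summit.HodgeConjecture.HodgeConjecture.Cruxes.H413.K2E3EPConstantIndexFormUnramified
open Summit.HodgeConjecture.HodgeConjecture.Cruxes.H413.K2E3EPIndicesRamified (relIndex_sharp_inf_level_eq_of_antifixed_uniformizer)

section Indices

variable (L : Type) [Field L] [NumberField L] [IsCMField L] {v : HeightOneSpectrum (𝓞 ↥(maximalRealSubfield L))}
  (w : PlacesOver L v) (hw : IsCMField.complexConj L • w.1 = w.1)

/-! ## §1 The two EP indices at a √u-type place for J2♯'s levels `K♯_η = e_w⁻¹(D_η GL₂(𝒪_w) D_η⁻¹)`, `K⁰ = U(Φ₂)(𝒪_v)` -/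

include hw in
/-- **`[K♯_η : K♯_η ⊓ K⁰] = 2` and `[K⁰ : K♯_η ⊓ K⁰] = q_v + 1` AT A √u-TYPE RAMIFIED PLACE** (`e(w|v) ≠ 1`, `α` an anti-fixed UNIT of `L_w`, `η` any uniformiser of `L_w`) for J2♯'s
levels `K♯_η = e_w⁻¹(D_η GL₂(𝒪_w) D_η⁻¹)` (★ `mem_comap_map_conj_glInt_iff`) and `K⁰ = U(Φ₂)(𝒪_v)`: ★ LH4-p05 F6 in the `P♯` currency (★ `forall_v_sharp_iff_coe_mem_map_conj`),
`q_v = |𝓞_{L⁺}∕v|` (Mathlib `Ideal.absNorm_apply`).  The roles of vertex and edge are EXCHANGED with respect to the √π case ★ `relIndex_sharp_inf_level_eq_of_antifixed_uniformizer`.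
[cite: Tits1979, §3.7, §3.9] [cite: Serre1980Trees, Ch. II §1.3] [cite: Kottwitz1988, §2] [cite: Jacobowitz1962, §5] -/
theorem relIndex_sharp_inf_level_eq_of_antifixed_unit (he : v.asIdeal.ramificationIdx' w.1.asIdeal ≠ 1)
    {α : w.1.adicCompletion L} (hvα : Valued.v α = 1) (hα : galAdicCompletionMap (L := L) (IsCMField.complexConj L) hw α = -α)
    (η : (w.1.adicCompletion L)ˣ) (hη : Valued.v (η : w.1.adicCompletion L) = WithZero.exp (-1 : ℤ)) :
    ((((glInt 2 (w.1.adicCompletion L)).map (MulAut.conj (glDiagonal 2 (w.1.adicCompletion L) ![1, η])).toMonoidHom).comap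
          (((unitaryGroupOfForm (galAdicCompletionMap (L := L) (IsCMField.complexConj L) hw) (placeForm (Matrix.of fun i j : Fin 2 => if i.val + j.val + 1 = 2 then (1 : L) else 0) w.1)).subtype.comp
            (localNonsplitEquiv (IsCMField.complexConj L) (Matrix.of fun i j : Fin 2 => if i.val + j.val + 1 = 2 then (1 : L) else 0)
          (IsCMField.complexConj_ne_one L) w hw).toMonoidHom :
            (cmDatum L 2 (Matrix.of fun i j : Fin 2 => if i.val + j.val + 1 = 2 then (1 : L) else 0)).Local v →* GL (Fin 2) (w.1.adicCompletion L)))) ⊓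
        cmLocalIntegralLevel L 2 (Matrix.of fun i j : Fin 2 => if i.val + j.val + 1 = 2 then (1 : L) else 0) v).relIndex
      ((((glInt 2 (w.1.adicCompletion L)).map (MulAut.conj (glDiagonal 2 (w.1.adicCompletion L) ![1, η])).toMonoidHom).comap
          (((unitaryGroupOfForm (galAdicCompletionMap (L := L) (IsCMField.complexConj L) hw) (placeForm (Matrix.of fun i j : Fin 2 => if i.val + j.val + 1 = 2 then (1 : L) else 0) w.1)).subtype.comp
            (localNonsplitEquiv (IsCMField.complexConj L) (Matrix.of fun i j : Fin 2 => if i.val + j.val + 1 = 2 then (1 : L) else 0)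
          (IsCMField.complexConj_ne_one L) w hw).toMonoidHom :
            (cmDatum L 2 (Matrix.of fun i j : Fin 2 => if i.val + j.val + 1 = 2 then (1 : L) else 0)).Local v →* GL (Fin 2) (w.1.adicCompletion L))))) =
        2 ∧
    ((((glInt 2 (w.1.adicCompletion L)).map (MulAut.conj (glDiagonal 2 (w.1.adicCompletion L) ![1, η])).toMonoidHom).comap
          (((unitaryGroupOfForm (galAdicCompletionMap (L := L) (IsCMField.complexConj L) hw) (placeForm (Matrix.of fun i j : Fin 2 => if i.val + j.val + 1 = 2 then (1 : L) else 0) w.1)).subtype.comp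
            (localNonsplitEquiv (IsCMField.complexConj L) (Matrix.of fun i j : Fin 2 => if i.val + j.val + 1 = 2 then (1 : L) else 0)
          (IsCMField.complexConj_ne_one L) w hw).toMonoidHom :
            (cmDatum L 2 (Matrix.of fun i j : Fin 2 => if i.val + j.val + 1 = 2 then (1 : L) else 0)).Local v →* GL (Fin 2) (w.1.adicCompletion L)))) ⊓
        cmLocalIntegralLevel L 2 (Matrix.of fun i j : Fin 2 => if i.val + j.val + 1 = 2 then (1 : L) else 0) v).relIndex
      (cmLocalIntegralLevel L 2 (Matrix.of fun i j : Fin 2 => if i.val + j.val + 1 = 2 then (1 : L) else 0) v) =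
        Nat.card (𝓞 ↥(maximalRealSubfield L) ⧸ v.asIdeal) + 1 := by
  classical
  -- J2♯'s `K♯_η` in the `P♯` currency of ★ F6
  have hKs : ∀ g : ↥(unitaryGroupOfForm (conjLocal L (IsCMField.complexConj L) v) (cmLocalForm L 2 v)),
      g ∈ (((glInt 2 (w.1.adicCompletion L)).map (MulAut.conj (glDiagonal 2 (w.1.adicCompletion L) ![1, η])).toMonoidHom).comap
          (((unitaryGroupOfForm (galAdicCompletionMap (L := L) (IsCMField.complexConj L) hw) (placeForm (Matrix.of fun i j : Fin 2 => if i.val + j.val + 1 = 2 then (1 : L) else 0) w.1)).subtype.comp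
            (localNonsplitEquiv (IsCMField.complexConj L) (Matrix.of fun i j : Fin 2 => if i.val + j.val + 1 = 2 then (1 : L) else 0)
          (IsCMField.complexConj_ne_one L) w hw).toMonoidHom :
            (cmDatum L 2 (Matrix.of fun i j : Fin 2 => if i.val + j.val + 1 = 2 then (1 : L) else 0)).Local v →* GL (Fin 2) (w.1.adicCompletion L)))) ↔
        (∀ a b : Fin 2, Valued.v ((η : (w.1.adicCompletion L)) ^ (b : ℕ) * ((η : (w.1.adicCompletion L)) ^ (a : ℕ))⁻¹ * ((((localNonsplitEquiv (IsCMField.complexConj L) (Matrix.of fun i j : Fin 2 => if i.val + j.val + 1 = 2 then (1 : L) else 0) (IsCMField.complexConj_ne_one L) w hw) g : ↥(unitaryGroupOfForm (galAdicCompletionMap (L := L) (IsCMField.complexConj L) hw) (placeForm (Matrix.of fun i j : Fin 2 => if i.val + j.val + 1 = 2 then (1 : L) else 0) w.1))) : GL (Fin 2) (w.1.adicCompletion L)) : Matrix (Fin 2) (Fin 2) (w.1.adicCompletion L)) a b) ≤ 1) := fun g =>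
    (mem_comap_map_conj_glInt_iff L w hw (glDiagonal 2 (w.1.adicCompletion L) ![1, η]) g).trans
      (forall_v_sharp_iff_coe_mem_map_conj L w hw η ((localNonsplitEquiv (IsCMField.complexConj L) (Matrix.of fun i j : Fin 2 => if i.val + j.val + 1 = 2 then (1 : L) else 0)
        (IsCMField.complexConj_ne_one L) w hw) g)).symm
  have hq : Ideal.absNorm v.asIdeal = Nat.card (𝓞 ↥(maximalRealSubfield L) ⧸ v.asIdeal) := by
    rw [Ideal.absNorm_apply, Submodule.cardQuot_apply]
  refine ⟨?_, ?_⟩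
  · exact index_inf_subgroupOf_sharp_eq_two_of_unit L v w hw he hvα hα (η : (w.1.adicCompletion L)) hη _ hKs
  · rw [← hq]
    exact index_inf_subgroupOf_cmLocalIntegralLevel_eq_of_unit L v w hw he hvα hα (η : (w.1.adicCompletion L)) hη _ hKs

end Indices

/-! ## §2 LETTER (E-w-π): the EP datum with `r · ν(K⁰) = (q_v − 1)∕(q_v + 1)` at a √π-type place -/
section Letter

variable (L : Type) [Field L] [NumberField L] [IsCMField L] {v : HeightOneSpectrum (𝓞 ↥(maximalRealSubfield L))}
  [MeasurableSpace ((cmDatum L 2 (Matrix.of fun i j : Fin 2 => if i.val + j.val + 1 = 2 then (1 : L) else 0)).Local v)]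
  [BorelSpace ((cmDatum L 2 (Matrix.of fun i j : Fin 2 => if i.val + j.val + 1 = 2 then (1 : L) else 0)).Local v)]
  [∀ γ : (cmDatum L 2 (Matrix.of fun i j : Fin 2 => if i.val + j.val + 1 = 2 then (1 : L) else 0)).Local v,
    MeasurableSpace (((cmDatum L 2 (Matrix.of fun i j : Fin 2 => if i.val + j.val + 1 = 2 then (1 : L) else 0)).Local v) ⧸
      Subgroup.centralizer ({γ} : Set ((cmDatum L 2 (Matrix.of fun i j : Fin 2 => if i.val + j.val + 1 = 2 then (1 : L) else 0)).Local v)))]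
  [∀ γ : (cmDatum L 2 (Matrix.of fun i j : Fin 2 => if i.val + j.val + 1 = 2 then (1 : L) else 0)).Local v,
    BorelSpace (((cmDatum L 2 (Matrix.of fun i j : Fin 2 => if i.val + j.val + 1 = 2 then (1 : L) else 0)).Local v) ⧸
      Subgroup.centralizer ({γ} : Set ((cmDatum L 2 (Matrix.of fun i j : Fin 2 => if i.val + j.val + 1 = 2 then (1 : L) else 0)).Local v)))]
  (ν : Measure ((cmDatum L 2 (Matrix.of fun i j : Fin 2 => if i.val + j.val + 1 = 2 then (1 : L) else 0)).Local v))
  [IsHaarMeasure ν] [ν.IsMulRightInvariant]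

set_option maxHeartbeats 800000 in  -- HB: the ROAD W tree-action binders are transported along `localNonsplitEquiv` (definitional `cmDatum.Local` unfoldings), as in ★ (E-ram) ∕ J2♯'s assembly
/-- **LETTER (E-w-π): THE EP DATUM AT A RAMIFIED PLACE OF √π TYPE, `r · ν₂(K₂) = (q_v − 1)∕(q_v + 1)`.**  For `v` ramified and non-split in `L` (`w ∣ v`, `w̄ = w`, `e(w|v) ≠ 1`)
carrying an anti-fixed UNIFORMISER `α` (every tame place; the wild places `L_w = L⁺_v(√(uπ))`), any two-sided Haar measure `ν₂` and canonical orbital measures `m₂` on `U(Φ₂)_v`, there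
are `f₂ ∈ C_c^∞(U(Φ₂)_v)` (Kottwitz's EP function of the edge `K⁰ = U(Φ₂)(𝒪_v)` and its end vertex `K♯_α`) and `r : ℝ` with orbital integrals `1 ∕ 0` on the regular elliptic ∕ split
classes, `f₂(b·1) = −r` at the central unit scalars, and **`r · ν₂(↑K₂).toReal = (q_v − 1)∕(q_v + 1)`** (`[K♯_α : I] = q_v + 1`, `[K⁰ : I] = 2`).  This is ★ (E-ram) p856782 with its
`2 ∉ v` traded for the type witness `α` (proof verbatim from its `hα0` line on); no `|2|` anywhere.
[cite: Kottwitz1988, §2 Theorem 2] [cite: Rogawski1990, §8.1 p. 117; §12.6 p. 174] [cite: Serre1980Trees, Ch. II §1.3] [cite: Tits1979, §3.9] -/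
theorem exists_epDatum_of_antifixed_uniformizer (w : PlacesOver L v) (hw : IsCMField.complexConj L • w.1 = w.1)
    (he : v.asIdeal.ramificationIdx' w.1.asIdeal ≠ 1) (α : (w.1.adicCompletion L)ˣ)
    (hα : galAdicCompletionMap (L := L) (IsCMField.complexConj L) hw (α : w.1.adicCompletion L) = -(α : w.1.adicCompletion L))
    (hvα : Valued.v (α : w.1.adicCompletion L) = WithZero.exp (-1 : ℤ))
    {m : OrbitalMeasureFamily ((cmDatum L 2 (Matrix.of fun i j : Fin 2 => if i.val + j.val + 1 = 2 then (1 : L) else 0)).Local v)}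
    (hm : m.IsCanonical (fun γ => IsRegularElt (γ.val : GL (Fin 2) (UnitaryGroup.LocalRing L v))) ν) :
    ∃ (f₂ : ((cmDatum L 2 (Matrix.of fun i j : Fin 2 => if i.val + j.val + 1 = 2 then (1 : L) else 0)).Local v) → ℂ) (r : ℝ), IsLocSmooth f₂ ∧
      (∀ γ : (cmDatum L 2 (Matrix.of fun i j : Fin 2 => if i.val + j.val + 1 = 2 then (1 : L) else 0)).Local v,
          IsRegularElt (γ.val : GL (Fin 2) (UnitaryGroup.LocalRing L v)) →
          CompactSpace (Subgroup.centralizer ({γ} : Set ((cmDatum L 2 (Matrix.of fun i j : Fin 2 => if i.val + j.val + 1 = 2 then (1 : L) else 0)).Local v))) →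
          classOrbitalIntegral m f₂ (ConjClasses.mk γ) = 1) ∧
      (∀ γ : (cmDatum L 2 (Matrix.of fun i j : Fin 2 => if i.val + j.val + 1 = 2 then (1 : L) else 0)).Local v,
          IsRegularElt (γ.val : GL (Fin 2) (UnitaryGroup.LocalRing L v)) →
          ¬ CompactSpace (Subgroup.centralizer ({γ} : Set ((cmDatum L 2 (Matrix.of fun i j : Fin 2 => if i.val + j.val + 1 = 2 then (1 : L) else 0)).Local v))) →
          classOrbitalIntegral m f₂ (ConjClasses.mk γ) = 0) ∧
      (∀ (z : (cmDatum L 2 (Matrix.of fun i j : Fin 2 => if i.val + j.val + 1 = 2 then (1 : L) else 0)).Local v) (b : LocalRing L v),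
          ((z.val : GL (Fin 2) (LocalRing L v)).val : Matrix (Fin 2) (Fin 2) (LocalRing L v)) = b • (1 : Matrix (Fin 2) (Fin 2) (LocalRing L v)) →
          f₂ z = -(r : ℂ)) ∧
      r * (ν (cmLocalIntegralLevel L 2 (Matrix.of fun i j : Fin 2 => if i.val + j.val + 1 = 2 then (1 : L) else 0) v :
          Set ((cmDatum L 2 (Matrix.of fun i j : Fin 2 => if i.val + j.val + 1 = 2 then (1 : L) else 0)).Local v))).toReal =
        ((Nat.card (𝓞 ↥(maximalRealSubfield L) ⧸ v.asIdeal) : ℝ) - 1) / ((Nat.card (𝓞 ↥(maximalRealSubfield L) ⧸ v.asIdeal) : ℝ) + 1) := by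
  classical
  have hα0 : (α : w.1.adicCompletion L) ≠ 0 := α.ne_zero
  -- ROAD W: the tree of `SL₂(L⁺_v)` with `U(Φ₂)_v` acting through `rhoVertexActPlace`, keyed by `α` (√π-type): `K♯_{D_α}`-vertex `v₁`, `K⁰`-edge `{v₁, v₀}`
  obtain ⟨ϖF, hϖF⟩ : ∃ ϖF : v.adicCompletion ↥(maximalRealSubfield L), Valued.v ϖF = WithZero.exp (-1 : ℤ) :=
    ⟨_, HeckeCharacter.valued_uniformizer (K := ↥(maximalRealSubfield L)) (v := v)⟩
  haveI : IsDiscreteValuationRing 𝒪[v.adicCompletion ↥(maximalRealSubfield L)] := isDiscreteValuationRing_integer_of_compatible hϖF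
  have hϖ : IsUniformizingElement ϖF := isUniformizingElement_of_v_eq hϖF
  obtain ⟨g₁, hg₁, hdet₁⟩ := exists_coe_eq_diagonal_one_uniformizer (F := v.adicCompletion ↥(maximalRealSubfield L)) hϖ.ne_zero
  obtain ⟨v₀, v₁, hv₀, hv₁⟩ : ∃ v₀ v₁ : {M : Submodule 𝒪[v.adicCompletion ↥(maximalRealSubfield L)] (Fin 2 → v.adicCompletion ↥(maximalRealSubfield L)) //
      IsSpecialLattice (RingHom.id _) ϖF !![(0 : v.adicCompletion ↥(maximalRealSubfield L)), 1; -1, 0] M},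
      v₀.1 = latt (1 : Matrix (Fin 2) (Fin 2) (v.adicCompletion ↥(maximalRealSubfield L))) ∧
        v₁.1 = latt (Matrix.diagonal ![(1 : v.adicCompletion ↥(maximalRealSubfield L)), ϖF]) :=
    ⟨⟨latt (1 : Matrix (Fin 2) (Fin 2) (v.adicCompletion ↥(maximalRealSubfield L))),
        Or.inl ((isSelfDualLattice_id_altJ_iff _).2 ⟨1, by rw [Units.val_one], by rw [Units.val_one, det_one, map_one]⟩)⟩,
      ⟨latt (Matrix.diagonal ![(1 : v.adicCompletion ↥(maximalRealSubfield L)), ϖF]),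
        Or.inr ((isModularLattice_id_altJ_iff hϖ.ne_zero _).2 ⟨g₁, by rw [hg₁], by rw [hdet₁]⟩)⟩, rfl, rfl⟩
  have hX := isTree_latticeTree_id_altJ hϖ
  have h01 := latticeTree_adj_root hϖ v₀ v₁ hv₀ hv₁
  have hE := fun (γ : (cmDatum L 2 (Matrix.of fun i j : Fin 2 => if i.val + j.val + 1 = 2 then (1 : L) else 0)).Local v)
      (hreg : IsRegularElt (γ.val : GL (Fin 2) (UnitaryGroup.LocalRing L v)))
      (hc : CompactSpace (Subgroup.centralizer ({γ} : Set ((cmDatum L 2 (Matrix.of fun i j : Fin 2 => if i.val + j.val + 1 = 2 then (1 : L) else 0)).Local v)))) =>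
    epEllipticRelation_vertexEdgeLevels_of_vertexAction_local L w hw (glDiagonal 2 (w.1.adicCompletion L) ![1, α]) hX
      (rhoVertexActPlace L v w hw hα hα0 hϖF) (rhoVertexActPlace_one L v w hw hα hα0 hϖF) (rhoVertexActPlace_mul L v w hw hα hα0 hϖF)
      (latticeTree_adj_rhoVertexActPlace_iff L v w hw hα hα0 hϖF) h01.symm (exists_rhoVertexActPlace_eq' L v w hw hα hα0 hϖF he v₁)
      (fun _ _ hab => exists_rhoVertexActPlace_eq_of_adj' L v w hw hα hα0 hϖF he v₁ v₀ hv₁ hv₀ hab)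
      (forall_coe_mem_map_conj_glDiagonal_iff_rhoVertexActPlace_next_eq L v w hw hα hα0 hϖF v₁ hv₁ he hvα α hvα)
      (forall_coe_mem_glInt_iff_sym2_rhoVertexActPlace_eq L v w hw hα hα0 hϖF v₀ v₁ hv₀ hv₁ he hvα) γ hreg hc
  have hN := fun (γ : (cmDatum L 2 (Matrix.of fun i j : Fin 2 => if i.val + j.val + 1 = 2 then (1 : L) else 0)).Local v)
      (hreg : IsRegularElt (γ.val : GL (Fin 2) (UnitaryGroup.LocalRing L v)))
      (hnc : ¬ CompactSpace (Subgroup.centralizer ({γ} : Set ((cmDatum L 2 (Matrix.of fun i j : Fin 2 => if i.val + j.val + 1 = 2 then (1 : L) else 0)).Local v)))) =>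
    epNonEllipticRelation_vertexEdgeLevels_of_vertexAction_local L w hw α hvα ν ![1, α] hm hX
      (rhoVertexActPlace L v w hw hα hα0 hϖF) (rhoVertexActPlace_one L v w hw hα hα0 hϖF) (rhoVertexActPlace_mul L v w hw hα hα0 hϖF)
      (latticeTree_adj_rhoVertexActPlace_iff L v w hw hα hα0 hϖF) h01.symm (exists_rhoVertexActPlace_eq' L v w hw hα hα0 hϖF he v₁)
      (fun _ _ hab => exists_rhoVertexActPlace_eq_of_adj' L v w hw hα hα0 hϖF he v₁ v₀ hv₁ hv₀ hab)
      (forall_coe_mem_map_conj_glDiagonal_iff_rhoVertexActPlace_next_eq L v w hw hα hα0 hϖF v₁ hv₁ he hvα α hvα)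
      (forall_coe_mem_glInt_iff_sym2_rhoVertexActPlace_eq L v w hw hα hα0 hϖF v₀ v₁ hv₀ hv₁ he hvα)
      (latticeTree_adj_root_rhoVertexActPlace_of_coe_eq_diagonal' L v w hw hα hα0 hϖF he α hvα v₁ hv₁) γ hreg hnc
  -- the levels are compact open; the glue WITH VALUE
  obtain ⟨hSc, hSo⟩ := isCompact_isOpen_comap_map_conj_glInt L w hw (glDiagonal 2 (w.1.adicCompletion L) ![1, α])
  obtain ⟨hKc, hKo⟩ := isCompact_isOpen_cmLocalIntegralLevel L 2 (Matrix.of fun i j : Fin 2 => if i.val + j.val + 1 = 2 then (1 : L) else 0) v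
  obtain ⟨hIc, hIo⟩ := isCompact_isOpen_comap_map_conj_glInt_inf_cmLocalIntegralLevel L w hw (glDiagonal 2 (w.1.adicCompletion L) ![1, α])
  obtain ⟨f, hf, h1, h0, hval⟩ := exists_isLocSmooth_classOrbitalIntegral_eq_one_zero_and_apply_of_relations L 2 _ v ν
    (UnitaryGroup.antidiagOne_isHermitian L 2) (UnitaryGroup.isUnit_antidiagOne_det L 2).ne_zero hm _ _ _ hSo hSc hKo hKc hIo hIc hE hN
  -- the two indices and the three masses
  obtain ⟨i1, i0⟩ := relIndex_sharp_inf_level_eq_of_antifixed_uniformizer L w hw he α hα hvα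
  have hmS := toReal_measure_coe_eq_relIndex_mul ν _ _ (inf_le_left : (((glInt 2 (w.1.adicCompletion L)).map (MulAut.conj (glDiagonal 2 (w.1.adicCompletion L) ![1, α])).toMonoidHom).comap
          (((unitaryGroupOfForm (galAdicCompletionMap (L := L) (IsCMField.complexConj L) hw) (placeForm (Matrix.of fun i j : Fin 2 => if i.val + j.val + 1 = 2 then (1 : L) else 0) w.1)).subtype.comp
            (localNonsplitEquiv (IsCMField.complexConj L) (Matrix.of fun i j : Fin 2 => if i.val + j.val + 1 = 2 then (1 : L) else 0)
          (IsCMField.complexConj_ne_one L) w hw).toMonoidHom :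
            (cmDatum L 2 (Matrix.of fun i j : Fin 2 => if i.val + j.val + 1 = 2 then (1 : L) else 0)).Local v →* GL (Fin 2) (w.1.adicCompletion L)))) ⊓
        cmLocalIntegralLevel L 2 (Matrix.of fun i j : Fin 2 => if i.val + j.val + 1 = 2 then (1 : L) else 0) v ≤ _) hSo hSc hIo
  have hmK := toReal_measure_coe_eq_relIndex_mul ν _ _ (inf_le_right : (((glInt 2 (w.1.adicCompletion L)).map (MulAut.conj (glDiagonal 2 (w.1.adicCompletion L) ![1, α])).toMonoidHom).comap
          (((unitaryGroupOfForm (galAdicCompletionMap (L := L) (IsCMField.complexConj L) hw) (placeForm (Matrix.of fun i j : Fin 2 => if i.val + j.val + 1 = 2 then (1 : L) else 0) w.1)).subtype.comp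
            (localNonsplitEquiv (IsCMField.complexConj L) (Matrix.of fun i j : Fin 2 => if i.val + j.val + 1 = 2 then (1 : L) else 0)
          (IsCMField.complexConj_ne_one L) w hw).toMonoidHom :
            (cmDatum L 2 (Matrix.of fun i j : Fin 2 => if i.val + j.val + 1 = 2 then (1 : L) else 0)).Local v →* GL (Fin 2) (w.1.adicCompletion L)))) ⊓
        cmLocalIntegralLevel L 2 (Matrix.of fun i j : Fin 2 => if i.val + j.val + 1 = 2 then (1 : L) else 0) v ≤ _) hKo hKc hIo
  rw [i1] at hmS
  rw [i0] at hmK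
  have hI0 := toReal_measure_pos_of_isOpen_isCompact ν _ hIo hIc
  set q : ℕ := Nat.card (𝓞 ↥(maximalRealSubfield L) ⧸ v.asIdeal) with hq
  have hq1 : (q : ℝ) + 1 ≠ 0 := by positivity
  -- the three masses as real numbers
  set a : ℝ := (ν ((((glInt 2 (w.1.adicCompletion L)).map (MulAut.conj (glDiagonal 2 (w.1.adicCompletion L) ![1, α])).toMonoidHom).comap
          (((unitaryGroupOfForm (galAdicCompletionMap (L := L) (IsCMField.complexConj L) hw) (placeForm (Matrix.of fun i j : Fin 2 => if i.val + j.val + 1 = 2 then (1 : L) else 0) w.1)).subtype.comp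
            (localNonsplitEquiv (IsCMField.complexConj L) (Matrix.of fun i j : Fin 2 => if i.val + j.val + 1 = 2 then (1 : L) else 0)
          (IsCMField.complexConj_ne_one L) w hw).toMonoidHom :
            (cmDatum L 2 (Matrix.of fun i j : Fin 2 => if i.val + j.val + 1 = 2 then (1 : L) else 0)).Local v →* GL (Fin 2) (w.1.adicCompletion L)))) : Set ((cmDatum L 2 (Matrix.of fun i j : Fin 2 => if i.val + j.val + 1 = 2 then (1 : L) else 0)).Local v))).toReal with ha
  set b : ℝ := (ν (cmLocalIntegralLevel L 2 (Matrix.of fun i j : Fin 2 => if i.val + j.val + 1 = 2 then (1 : L) else 0) v : Set ((cmDatum L 2 (Matrix.of fun i j : Fin 2 => if i.val + j.val + 1 = 2 then (1 : L) else 0)).Local v))).toReal with hb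
  set c : ℝ := (ν (↑((((glInt 2 (w.1.adicCompletion L)).map (MulAut.conj (glDiagonal 2 (w.1.adicCompletion L) ![1, α])).toMonoidHom).comap
          (((unitaryGroupOfForm (galAdicCompletionMap (L := L) (IsCMField.complexConj L) hw) (placeForm (Matrix.of fun i j : Fin 2 => if i.val + j.val + 1 = 2 then (1 : L) else 0) w.1)).subtype.comp
            (localNonsplitEquiv (IsCMField.complexConj L) (Matrix.of fun i j : Fin 2 => if i.val + j.val + 1 = 2 then (1 : L) else 0)
          (IsCMField.complexConj_ne_one L) w hw).toMonoidHom :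
            (cmDatum L 2 (Matrix.of fun i j : Fin 2 => if i.val + j.val + 1 = 2 then (1 : L) else 0)).Local v →* GL (Fin 2) (w.1.adicCompletion L)))) ⊓
        cmLocalIntegralLevel L 2 (Matrix.of fun i j : Fin 2 => if i.val + j.val + 1 = 2 then (1 : L) else 0) v) : Set ((cmDatum L 2 (Matrix.of fun i j : Fin 2 => if i.val + j.val + 1 = 2 then (1 : L) else 0)).Local v))).toReal with hc
  have hc0 : c ≠ 0 := hI0.ne'
  -- the datum
  refine ⟨f, c⁻¹ - a⁻¹ - b⁻¹, hf, h1, h0, fun z b' hz => ?_, ?_⟩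
  · obtain ⟨hzS, hzK, hzI⟩ := scalar_mem_vertexEdgeLevels L w hw (glDiagonal 2 (w.1.adicCompletion L) ![1, α]) z b' hz
    rw [hval z hzS hzK hzI]
    exact inv_add_inv_sub_inv_eq_neg a b c
  · rw [hmK, hmS]
    push_cast
    field_simp
    ring

/-! ## §3 LETTER (E-w-u): the EP datum with `r · ν(K⁰) = (q_v − 1)∕2` at a √u-type place -/
set_option maxHeartbeats 800000 in  -- HB: as in §2 (ROAD W binders transported along `localNonsplitEquiv`)
/-- **LETTER (E-w-u): THE EP DATUM AT A RAMIFIED PLACE OF √u TYPE, `r · ν₂(K₂) = (q_v − 1)∕2`.**  For `v` ramified and non-split in `L` (`w ∣ v`, `w̄ = w`, `e(w|v) ≠ 1`) carrying an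
anti-fixed UNIT `α` (only wild places, `2 ∈ v`, `L_w = L⁺_v(√u)`), any two-sided Haar measure `ν₂` and canonical orbital measures `m₂` on `U(Φ₂)_v`, there are `f₂ ∈ C_c^∞(U(Φ₂)_v)`
(Kottwitz's EP function of the VERTEX stabiliser `K⁰ = U(Φ₂)(𝒪_v)` and the edge stabiliser `K♯_η`, `η` a uniformiser of `L_w`) and `r : ℝ` with orbital integrals `1 ∕ 0` on the regular
elliptic ∕ split classes, `f₂(b·1) = −r` at the central unit scalars, and **`r · ν₂(↑K₂).toReal = (q_v − 1)∕2`** (`[K⁰ : I] = q_v + 1`, `[K♯_η : I] = 2`: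
`r · ν₂(K⁰) = (q+1)·(1 − 1∕2 − 1∕(q+1)) = (q − 1)∕2`).  The primed ROAD W lemmas of ★ `rankOneEulerPoincareNonsplit_holds` (√u branch) feed (E), (N); ★ F6 gives the indices (§1).
[cite: Kottwitz1988, §2 Theorem 2] [cite: Rogawski1990, §8.1 p. 117; §12.6 p. 174] [cite: Serre1980Trees, Ch. II §1.3] [cite: Tits1979, §3.7, §3.9] [cite: Jacobowitz1962, §5] -/
theorem exists_epDatum_of_antifixed_unit (w : PlacesOver L v) (hw : IsCMField.complexConj L • w.1 = w.1)
    (he : v.asIdeal.ramificationIdx' w.1.asIdeal ≠ 1) (α : (w.1.adicCompletion L)ˣ)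
    (hα : galAdicCompletionMap (L := L) (IsCMField.complexConj L) hw (α : w.1.adicCompletion L) = -(α : w.1.adicCompletion L))
    (hvα : Valued.v (α : w.1.adicCompletion L) = 1)
    {m : OrbitalMeasureFamily ((cmDatum L 2 (Matrix.of fun i j : Fin 2 => if i.val + j.val + 1 = 2 then (1 : L) else 0)).Local v)}
    (hm : m.IsCanonical (fun γ => IsRegularElt (γ.val : GL (Fin 2) (UnitaryGroup.LocalRing L v))) ν) :
    ∃ (f₂ : ((cmDatum L 2 (Matrix.of fun i j : Fin 2 => if i.val + j.val + 1 = 2 then (1 : L) else 0)).Local v) → ℂ) (r : ℝ), IsLocSmooth f₂ ∧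
      (∀ γ : (cmDatum L 2 (Matrix.of fun i j : Fin 2 => if i.val + j.val + 1 = 2 then (1 : L) else 0)).Local v,
          IsRegularElt (γ.val : GL (Fin 2) (UnitaryGroup.LocalRing L v)) →
          CompactSpace (Subgroup.centralizer ({γ} : Set ((cmDatum L 2 (Matrix.of fun i j : Fin 2 => if i.val + j.val + 1 = 2 then (1 : L) else 0)).Local v))) →
          classOrbitalIntegral m f₂ (ConjClasses.mk γ) = 1) ∧
      (∀ γ : (cmDatum L 2 (Matrix.of fun i j : Fin 2 => if i.val + j.val + 1 = 2 then (1 : L) else 0)).Local v,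
          IsRegularElt (γ.val : GL (Fin 2) (UnitaryGroup.LocalRing L v)) →
          ¬ CompactSpace (Subgroup.centralizer ({γ} : Set ((cmDatum L 2 (Matrix.of fun i j : Fin 2 => if i.val + j.val + 1 = 2 then (1 : L) else 0)).Local v))) →
          classOrbitalIntegral m f₂ (ConjClasses.mk γ) = 0) ∧
      (∀ (z : (cmDatum L 2 (Matrix.of fun i j : Fin 2 => if i.val + j.val + 1 = 2 then (1 : L) else 0)).Local v) (b : LocalRing L v),
          ((z.val : GL (Fin 2) (LocalRing L v)).val : Matrix (Fin 2) (Fin 2) (LocalRing L v)) = b • (1 : Matrix (Fin 2) (Fin 2) (LocalRing L v)) →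
          f₂ z = -(r : ℂ)) ∧
      r * (ν (cmLocalIntegralLevel L 2 (Matrix.of fun i j : Fin 2 => if i.val + j.val + 1 = 2 then (1 : L) else 0) v :
          Set ((cmDatum L 2 (Matrix.of fun i j : Fin 2 => if i.val + j.val + 1 = 2 then (1 : L) else 0)).Local v))).toReal =
        ((Nat.card (𝓞 ↥(maximalRealSubfield L) ⧸ v.asIdeal) : ℝ) - 1) / 2 := by
  classical
  have hα0 : (α : w.1.adicCompletion L) ≠ 0 := α.ne_zero
  -- a uniformiser `η` of `L_w` keys J2♯'s level `K♯_η = e_w⁻¹(D_η GL₂(𝒪_w) D_η⁻¹)` (at a √u place the anti-fixed `α` is a unit, so `D_α` would give `K♯ = K⁰`)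
  obtain ⟨η, hη⟩ : ∃ η : (w.1.adicCompletion L)ˣ, Valued.v (η : w.1.adicCompletion L) = WithZero.exp (-1 : ℤ) :=
    ⟨_, HeckeCharacter.valued_uniformizer (K := L) (v := w.1)⟩
  -- ROAD W: the tree of `SL₂(L⁺_v)` with `U(Φ₂)_v` acting through `rhoVertexActPlace` (√u-type): `K⁰`-vertex `v₀`, `K♯_{D_η}`-edge `{v₀, v₁}` with its inversion
  obtain ⟨ϖF, hϖF⟩ : ∃ ϖF : v.adicCompletion ↥(maximalRealSubfield L), Valued.v ϖF = WithZero.exp (-1 : ℤ) :=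
    ⟨_, HeckeCharacter.valued_uniformizer (K := ↥(maximalRealSubfield L)) (v := v)⟩
  haveI : IsDiscreteValuationRing 𝒪[v.adicCompletion ↥(maximalRealSubfield L)] := isDiscreteValuationRing_integer_of_compatible hϖF
  have hϖ : IsUniformizingElement ϖF := isUniformizingElement_of_v_eq hϖF
  obtain ⟨g₁, hg₁, hdet₁⟩ := exists_coe_eq_diagonal_one_uniformizer (F := v.adicCompletion ↥(maximalRealSubfield L)) hϖ.ne_zero
  obtain ⟨v₀, v₁, hv₀, hv₁⟩ : ∃ v₀ v₁ : {M : Submodule 𝒪[v.adicCompletion ↥(maximalRealSubfield L)] (Fin 2 → v.adicCompletion ↥(maximalRealSubfield L)) //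
      IsSpecialLattice (RingHom.id _) ϖF !![(0 : v.adicCompletion ↥(maximalRealSubfield L)), 1; -1, 0] M},
      v₀.1 = latt (1 : Matrix (Fin 2) (Fin 2) (v.adicCompletion ↥(maximalRealSubfield L))) ∧
        v₁.1 = latt (Matrix.diagonal ![(1 : v.adicCompletion ↥(maximalRealSubfield L)), ϖF]) :=
    ⟨⟨latt (1 : Matrix (Fin 2) (Fin 2) (v.adicCompletion ↥(maximalRealSubfield L))),
        Or.inl ((isSelfDualLattice_id_altJ_iff _).2 ⟨1, by rw [Units.val_one], by rw [Units.val_one, det_one, map_one]⟩)⟩,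
      ⟨latt (Matrix.diagonal ![(1 : v.adicCompletion ↥(maximalRealSubfield L)), ϖF]),
        Or.inr ((isModularLattice_id_altJ_iff hϖ.ne_zero _).2 ⟨g₁, by rw [hg₁], by rw [hdet₁]⟩)⟩, rfl, rfl⟩
  have hX := isTree_latticeTree_id_altJ hϖ
  have h01 := latticeTree_adj_root hϖ v₀ v₁ hv₀ hv₁
  have hE := fun (γ : (cmDatum L 2 (Matrix.of fun i j : Fin 2 => if i.val + j.val + 1 = 2 then (1 : L) else 0)).Local v)
      (hreg : IsRegularElt (γ.val : GL (Fin 2) (UnitaryGroup.LocalRing L v)))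
      (hc : CompactSpace (Subgroup.centralizer ({γ} : Set ((cmDatum L 2 (Matrix.of fun i j : Fin 2 => if i.val + j.val + 1 = 2 then (1 : L) else 0)).Local v)))) =>
    epEllipticRelation_vertexEdgeLevels_of_vertexAction_local' L w hw (glDiagonal 2 (w.1.adicCompletion L) ![1, η]) hX
      (rhoVertexActPlace L v w hw hα hα0 hϖF) (rhoVertexActPlace_one L v w hw hα hα0 hϖF) (rhoVertexActPlace_mul L v w hw hα hα0 hϖF)
      (latticeTree_adj_rhoVertexActPlace_iff L v w hw hα hα0 hϖF) h01 (exists_rhoVertexActPlace_eq L v w hw hα hα0 hϖF he v₀ hv₀)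
      (fun _ _ hab => exists_rhoVertexActPlace_eq_of_adj L v w hw hα hα0 hϖF he v₀ v₁ hv₀ hv₁ hab)
      (forall_coe_mem_glInt_iff_rhoVertexActPlace_root_eq L v w hw hα hα0 hϖF v₀ hv₀ hvα)
      (forall_coe_mem_map_conj_glDiagonal_iff_sym2_rhoVertexActPlace_eq L v w hw hα hα0 hϖF v₀ v₁ hv₀ hv₁ he hvα η hη) γ hreg hc
  have hN := fun (γ : (cmDatum L 2 (Matrix.of fun i j : Fin 2 => if i.val + j.val + 1 = 2 then (1 : L) else 0)).Local v)
      (hreg : IsRegularElt (γ.val : GL (Fin 2) (UnitaryGroup.LocalRing L v)))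
      (hnc : ¬ CompactSpace (Subgroup.centralizer ({γ} : Set ((cmDatum L 2 (Matrix.of fun i j : Fin 2 => if i.val + j.val + 1 = 2 then (1 : L) else 0)).Local v)))) =>
    epNonEllipticRelation_vertexEdgeLevels_of_vertexAction_local' L w hw η hη ν ![1, η] hm hX
      (rhoVertexActPlace L v w hw hα hα0 hϖF) (rhoVertexActPlace_one L v w hw hα hα0 hϖF) (rhoVertexActPlace_mul L v w hw hα hα0 hϖF)
      (latticeTree_adj_rhoVertexActPlace_iff L v w hw hα hα0 hϖF) h01 (exists_rhoVertexActPlace_eq L v w hw hα hα0 hϖF he v₀ hv₀)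
      (fun _ _ hab => exists_rhoVertexActPlace_eq_of_adj L v w hw hα hα0 hϖF he v₀ v₁ hv₀ hv₁ hab)
      (forall_coe_mem_glInt_iff_rhoVertexActPlace_root_eq L v w hw hα hα0 hϖF v₀ hv₀ hvα)
      (forall_coe_mem_map_conj_glDiagonal_iff_sym2_rhoVertexActPlace_eq L v w hw hα hα0 hϖF v₀ v₁ hv₀ hv₁ he hvα η hη)
      (latticeTree_adj_root_rhoVertexActPlace_of_coe_eq_diagonal L v w hw hα hα0 hϖF he η hη v₀ hv₀) γ hreg hnc
  -- the levels are compact open; the glue WITH VALUE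
  obtain ⟨hSc, hSo⟩ := isCompact_isOpen_comap_map_conj_glInt L w hw (glDiagonal 2 (w.1.adicCompletion L) ![1, η])
  obtain ⟨hKc, hKo⟩ := isCompact_isOpen_cmLocalIntegralLevel L 2 (Matrix.of fun i j : Fin 2 => if i.val + j.val + 1 = 2 then (1 : L) else 0) v
  obtain ⟨hIc, hIo⟩ := isCompact_isOpen_comap_map_conj_glInt_inf_cmLocalIntegralLevel L w hw (glDiagonal 2 (w.1.adicCompletion L) ![1, η])
  obtain ⟨f, hf, h1, h0, hval⟩ := exists_isLocSmooth_classOrbitalIntegral_eq_one_zero_and_apply_of_relations L 2 _ v ν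
    (UnitaryGroup.antidiagOne_isHermitian L 2) (UnitaryGroup.isUnit_antidiagOne_det L 2).ne_zero hm _ _ _ hSo hSc hKo hKc hIo hIc hE hN
  -- the two indices and the three masses
  obtain ⟨i1, i0⟩ := relIndex_sharp_inf_level_eq_of_antifixed_unit L w hw he hvα hα η hη
  have hmS := toReal_measure_coe_eq_relIndex_mul ν _ _ (inf_le_left : (((glInt 2 (w.1.adicCompletion L)).map (MulAut.conj (glDiagonal 2 (w.1.adicCompletion L) ![1, η])).toMonoidHom).comap
          (((unitaryGroupOfForm (galAdicCompletionMap (L := L) (IsCMField.complexConj L) hw) (placeForm (Matrix.of fun i j : Fin 2 => if i.val + j.val + 1 = 2 then (1 : L) else 0) w.1)).subtype.comp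
            (localNonsplitEquiv (IsCMField.complexConj L) (Matrix.of fun i j : Fin 2 => if i.val + j.val + 1 = 2 then (1 : L) else 0)
          (IsCMField.complexConj_ne_one L) w hw).toMonoidHom :
            (cmDatum L 2 (Matrix.of fun i j : Fin 2 => if i.val + j.val + 1 = 2 then (1 : L) else 0)).Local v →* GL (Fin 2) (w.1.adicCompletion L)))) ⊓
        cmLocalIntegralLevel L 2 (Matrix.of fun i j : Fin 2 => if i.val + j.val + 1 = 2 then (1 : L) else 0) v ≤ _) hSo hSc hIo
  have hmK := toReal_measure_coe_eq_relIndex_mul ν _ _ (inf_le_right : (((glInt 2 (w.1.adicCompletion L)).map (MulAut.conj (glDiagonal 2 (w.1.adicCompletion L) ![1, η])).toMonoidHom).comap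
          (((unitaryGroupOfForm (galAdicCompletionMap (L := L) (IsCMField.complexConj L) hw) (placeForm (Matrix.of fun i j : Fin 2 => if i.val + j.val + 1 = 2 then (1 : L) else 0) w.1)).subtype.comp
            (localNonsplitEquiv (IsCMField.complexConj L) (Matrix.of fun i j : Fin 2 => if i.val + j.val + 1 = 2 then (1 : L) else 0)
          (IsCMField.complexConj_ne_one L) w hw).toMonoidHom :
            (cmDatum L 2 (Matrix.of fun i j : Fin 2 => if i.val + j.val + 1 = 2 then (1 : L) else 0)).Local v →* GL (Fin 2) (w.1.adicCompletion L)))) ⊓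
        cmLocalIntegralLevel L 2 (Matrix.of fun i j : Fin 2 => if i.val + j.val + 1 = 2 then (1 : L) else 0) v ≤ _) hKo hKc hIo
  rw [i1] at hmS
  rw [i0] at hmK
  have hI0 := toReal_measure_pos_of_isOpen_isCompact ν _ hIo hIc
  set q : ℕ := Nat.card (𝓞 ↥(maximalRealSubfield L) ⧸ v.asIdeal) with hq
  have hq1 : (q : ℝ) + 1 ≠ 0 := by positivity
  -- the three masses as real numbers
  set a : ℝ := (ν ((((glInt 2 (w.1.adicCompletion L)).map (MulAut.conj (glDiagonal 2 (w.1.adicCompletion L) ![1, η])).toMonoidHom).comap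
          (((unitaryGroupOfForm (galAdicCompletionMap (L := L) (IsCMField.complexConj L) hw) (placeForm (Matrix.of fun i j : Fin 2 => if i.val + j.val + 1 = 2 then (1 : L) else 0) w.1)).subtype.comp
            (localNonsplitEquiv (IsCMField.complexConj L) (Matrix.of fun i j : Fin 2 => if i.val + j.val + 1 = 2 then (1 : L) else 0)
          (IsCMField.complexConj_ne_one L) w hw).toMonoidHom :
            (cmDatum L 2 (Matrix.of fun i j : Fin 2 => if i.val + j.val + 1 = 2 then (1 : L) else 0)).Local v →* GL (Fin 2) (w.1.adicCompletion L)))) : Set ((cmDatum L 2 (Matrix.of fun i j : Fin 2 => if i.val + j.val + 1 = 2 then (1 : L) else 0)).Local v))).toReal with ha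
  set b : ℝ := (ν (cmLocalIntegralLevel L 2 (Matrix.of fun i j : Fin 2 => if i.val + j.val + 1 = 2 then (1 : L) else 0) v : Set ((cmDatum L 2 (Matrix.of fun i j : Fin 2 => if i.val + j.val + 1 = 2 then (1 : L) else 0)).Local v))).toReal with hb
  set c : ℝ := (ν (↑((((glInt 2 (w.1.adicCompletion L)).map (MulAut.conj (glDiagonal 2 (w.1.adicCompletion L) ![1, η])).toMonoidHom).comap
          (((unitaryGroupOfForm (galAdicCompletionMap (L := L) (IsCMField.complexConj L) hw) (placeForm (Matrix.of fun i j : Fin 2 => if i.val + j.val + 1 = 2 then (1 : L) else 0) w.1)).subtype.comp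
            (localNonsplitEquiv (IsCMField.complexConj L) (Matrix.of fun i j : Fin 2 => if i.val + j.val + 1 = 2 then (1 : L) else 0)
          (IsCMField.complexConj_ne_one L) w hw).toMonoidHom :
            (cmDatum L 2 (Matrix.of fun i j : Fin 2 => if i.val + j.val + 1 = 2 then (1 : L) else 0)).Local v →* GL (Fin 2) (w.1.adicCompletion L)))) ⊓
        cmLocalIntegralLevel L 2 (Matrix.of fun i j : Fin 2 => if i.val + j.val + 1 = 2 then (1 : L) else 0) v) : Set ((cmDatum L 2 (Matrix.of fun i j : Fin 2 => if i.val + j.val + 1 = 2 then (1 : L) else 0)).Local v))).toReal with hc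
  have hc0 : c ≠ 0 := hI0.ne'
  -- the datum
  refine ⟨f, c⁻¹ - a⁻¹ - b⁻¹, hf, h1, h0, fun z b' hz => ?_, ?_⟩
  · obtain ⟨hzS, hzK, hzI⟩ := scalar_mem_vertexEdgeLevels L w hw (glDiagonal 2 (w.1.adicCompletion L) ![1, η]) z b' hz
    rw [hval z hzS hzK hzI]
    exact inv_add_inv_sub_inv_eq_neg a b c
  · rw [hmK, hmS]
    push_cast
    field_simp
    ring

/-! ## §4 Every ramified place: the two alternatives -/
/-- **THE EP DATUM AT EVERY RAMIFIED PLACE, TYPE-FREE**: `v` ramified and non-split in `L` (`e(w|v) ≠ 1`; tame or wild) ⇒ an EP datum `(f₂, r)` as in §2∕§3 with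
`r · ν₂(K₂) = (q−1)∕(q+1)` OR `r · ν₂(K₂) = (q−1)∕2`, according to the anti-fixed dichotomy ★ `exists_units_galAdicCompletionMap_complexConj_eq_neg_of_ramified` (uniformiser ∕ unit).
At `2 ∉ v` only the first alternative occurs (★ (E-ram)); at `2 ∈ v` both do. [cite: Kottwitz1988, §2 Theorem 2] [cite: Tits1979, §3.9] [cite: Jacobowitz1962, §5] -/
theorem exists_epDatum_of_ramified_either (w : PlacesOver L v) (hw : IsCMField.complexConj L • w.1 = w.1)
    (he : v.asIdeal.ramificationIdx' w.1.asIdeal ≠ 1)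
    {m : OrbitalMeasureFamily ((cmDatum L 2 (Matrix.of fun i j : Fin 2 => if i.val + j.val + 1 = 2 then (1 : L) else 0)).Local v)}
    (hm : m.IsCanonical (fun γ => IsRegularElt (γ.val : GL (Fin 2) (UnitaryGroup.LocalRing L v))) ν) :
    ∃ (f₂ : ((cmDatum L 2 (Matrix.of fun i j : Fin 2 => if i.val + j.val + 1 = 2 then (1 : L) else 0)).Local v) → ℂ) (r : ℝ), IsLocSmooth f₂ ∧
      (∀ γ : (cmDatum L 2 (Matrix.of fun i j : Fin 2 => if i.val + j.val + 1 = 2 then (1 : L) else 0)).Local v,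
          IsRegularElt (γ.val : GL (Fin 2) (UnitaryGroup.LocalRing L v)) →
          CompactSpace (Subgroup.centralizer ({γ} : Set ((cmDatum L 2 (Matrix.of fun i j : Fin 2 => if i.val + j.val + 1 = 2 then (1 : L) else 0)).Local v))) →
          classOrbitalIntegral m f₂ (ConjClasses.mk γ) = 1) ∧
      (∀ γ : (cmDatum L 2 (Matrix.of fun i j : Fin 2 => if i.val + j.val + 1 = 2 then (1 : L) else 0)).Local v,
          IsRegularElt (γ.val : GL (Fin 2) (UnitaryGroup.LocalRing L v)) →
          ¬ CompactSpace (Subgroup.centralizer ({γ} : Set ((cmDatum L 2 (Matrix.of fun i j : Fin 2 => if i.val + j.val + 1 = 2 then (1 : L) else 0)).Local v))) →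
          classOrbitalIntegral m f₂ (ConjClasses.mk γ) = 0) ∧
      (∀ (z : (cmDatum L 2 (Matrix.of fun i j : Fin 2 => if i.val + j.val + 1 = 2 then (1 : L) else 0)).Local v) (b : LocalRing L v),
          ((z.val : GL (Fin 2) (LocalRing L v)).val : Matrix (Fin 2) (Fin 2) (LocalRing L v)) = b • (1 : Matrix (Fin 2) (Fin 2) (LocalRing L v)) →
          f₂ z = -(r : ℂ)) ∧
      (r * (ν (cmLocalIntegralLevel L 2 (Matrix.of fun i j : Fin 2 => if i.val + j.val + 1 = 2 then (1 : L) else 0) v :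
          Set ((cmDatum L 2 (Matrix.of fun i j : Fin 2 => if i.val + j.val + 1 = 2 then (1 : L) else 0)).Local v))).toReal =
        ((Nat.card (𝓞 ↥(maximalRealSubfield L) ⧸ v.asIdeal) : ℝ) - 1) / ((Nat.card (𝓞 ↥(maximalRealSubfield L) ⧸ v.asIdeal) : ℝ) + 1) ∨
       r * (ν (cmLocalIntegralLevel L 2 (Matrix.of fun i j : Fin 2 => if i.val + j.val + 1 = 2 then (1 : L) else 0) v :
          Set ((cmDatum L 2 (Matrix.of fun i j : Fin 2 => if i.val + j.val + 1 = 2 then (1 : L) else 0)).Local v))).toReal =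
        ((Nat.card (𝓞 ↥(maximalRealSubfield L) ⧸ v.asIdeal) : ℝ) - 1) / 2)  := by
  obtain ⟨α, hα, hvα | hvα⟩ := exists_units_galAdicCompletionMap_complexConj_eq_neg_of_ramified L w hw he
  · obtain ⟨f, r, hf, h1, h0, hval, hr⟩ := exists_epDatum_of_antifixed_unit L ν w hw he α hα hvα hm
    exact ⟨f, r, hf, h1, h0, hval, Or.inr hr⟩
  · obtain ⟨f, r, hf, h1, h0, hval, hr⟩ := exists_epDatum_of_antifixed_uniformizer L ν w hw he α hα hvα hm
    exact ⟨f, r, hf, h1, h0, hval, Or.inl hr⟩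

end Letter

end Summit.HodgeConjecture.HodgeConjecture.Cruxes.H413.K2E3EPIndicesWild
end
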